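import Mathlib
import HarnessLib
import Summits.HubbardSuperconductivity.HubbardSuperconductivity.Theorems.KLProgrammeC4aNearCausticBoxCfg
import Summits.HubbardSuperconductivity.HubbardSuperconductivity.Theorems.KLProgrammeC4aNoWitnessBoxCfg

/-!
# Route `KLProgramme` — crux C4a, S3 brick (B4) «(U1)-HYBRID» part U3: THE PER-TILE DISPATCH OF THE UMKLAPP FIRST-ORDER LAYER WITH A CONFIGURATION-DEPENDENT,
# DIRECT-NULL NUMERATOR — three branches decided inside: no witness ⟹ far/monotone; witness on a sheet `m ≠ 0` ⟹ the near-caustic box; witness on the DIRECT sheet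
# `m = 0` ⟹ the numerator vanishes on the box and the box integral is `0`.  NO tangency margin.

Cell `gate-hubbard-kl`, seat hubbard-kl-k3c3-p3 (g36; row «implicit-function / monotonicity route for μ(n)»).  Located brick for the (C)-closer lane / the (M4)
assembly of the umklapp first-order ϑ-layer (stub (C) `stub_twoLeg_curvature` of `KLRegimeEngineV17F2`, stmt-HubbardSuperconductivity-20437), memo
HOME/hubbard-kl-k3c3-p3/U1-CAUSTIC-SUP.md §19 «(U1)-NUMERATOR-ϑ» / «(U1)-HYBRID».

WHY.  `…C4aBoxDispatch.box_integral_le` (p697550) (i) takes the loop numerator as `X e v` — but the first-order co-moving jet delivers the `ϑ`-dependent numerator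
`J(e,v+θ)·De_K(S(ϑ) − Φ(e,v+θ))[S′(ϑ)]` ((B3), `…C4aBubbleTubeDerivAll`) — and (ii) excludes the direct sheet by the zone row `hT0 : τ₀ < ‖S(ϑ) − 2Φ(0,v+θ)‖`, which
fails on the tangency neighbourhood `‖ϑ‖_𝕋 < ϑ_T`.  The hybrid design of memo §19 cures both at once: the umklapp numerator handed to this ladder is the TRUE numerator
times a smooth cut-off VANISHING where the pair momentum is within `τ₁` of the direct caustic `2·FS` (those configurations — the tangency region of the direct sheet —
are counted in the co-moving KEY-LEMMA currency of B4-DIRECT-COUNT, not here).  Hence the row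
  `hXnull : ∀ ϑ ∈ tile, ∀ e ∈ [−hi,hi], ∀ v, ‖S(ϑ) − 2Φ(0,v+θ)‖ ≤ τ₁ → X ϑ e v = 0`,  `hτ₁ : τ₀ + msD₁·(ℓ + 2(φb − φa)) ≤ τ₁`,
replaces `hT0`, and the dispatch has THREE branches: `by_cases` on the no-witness row of part 10 at its own margin `T ≤ τ₀` — if it holds, `noWitnessBox_integral_le_cfg`
(U2); if it fails with a witness `(ϑ₁, v₁, m)`: for `m ≠ 0`, `nearCausticBox_integral_le_cfg` (U1) on the `W_m`-extended loop window exactly as in p697550; for `m = 0`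
the witness says `‖S(ϑ₁) − 2Φ(0,v₁+θ)‖ ≤ T ≤ τ₀`, so by the angular Lipschitz bound `‖∂_sΦ‖ ≤ msD₁` (`norm_levelPoint_sub_le_abs`) EVERY configuration of the box has
`‖S(ϑ) − 2Φ(0,v+θ)‖ ≤ τ₀ + msD₁(ℓ + 2(φb−φa)) ≤ τ₁`, the numerator vanishes identically on the box, and the box integral is `0`.
* `norm_pairSum_sub_two_smul_le_of_near` — the Lipschitz transport of a direct-caustic witness over the box;
* **`umkBox_integral_le`** (HEADLINE): `∫_{α}^{α+ℓ} F ≤ max(b_near(ℓ, φb−φa+2W_m), ℓ·max(b_far, b_mono))` — p697550's bound BYTE-IDENTICAL, hypotheses = p697550's with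
  the numerator rows asked at every `ϑ` (`X : ℝ → ℝ → ℝ → ℝ`, joint continuity on `ℝ × [−hi,hi] × ℝ`), `hT0` replaced by `hXnull`/`hτ₁`.
Sizes binder shape + `FrameOK`/`GeomConstants`; nothing asserts (C), K3 or superconductivity.
References: FST II CPAM 51 (1998) §3 [cite: FeldmanSalmhoferTrubowitz1998]; Salmhofer 1999 §4.5.3 [cite: Salmhofer1999]; BGM 2003 §7.1 [cite: BenfattoGiulianiMastropietro2003].
-/



noncomputable section

namespace Summit.HubbardSuperconductivity.HubbardSuperconductivity.Theorems.C4a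

set_option linter.dupNamespace false -- summit = problem name (single-conjunct summit), D-0017

open Real Set MeasureTheory intervalIntegral
open Literature.MathematicalPhysics.QuantumLattice Literature.MathematicalPhysics.QuantumLattice.BandSectorCounting
open Literature.MathematicalPhysics.QuantumLattice.FermiRG
open Summit.HubbardSuperconductivity.HubbardSuperconductivity.Theorems.KLRegimeSplit
open Summit.HubbardSuperconductivity.HubbardSuperconductivity.Theorems.DispersionFlow
open Summit.HubbardSuperconductivity.HubbardSuperconductivity.Theorems.PerturbedFermiCurve

section Sizes

variable {K : TrigPolyC4v} {A : ℝ} (hA : ∀ p : Momentum, ∀ j ≤ 2, ‖iteratedFDeriv ℝ j (frameShift K) p‖ ≤ A) (hA20 : A ≤ 1 / 20)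
  (hd : klCurveD ≤ (bandBounds (show (-4 : ℝ) < -1.1 by norm_num) (show (-1.1 : ℝ) ≤ -0.1 by norm_num)
    (show (-0.1 : ℝ) < 0 by norm_num)).Dtmin - 2 * A)
  {μ r : ℝ} (hr : 0 < r) (hlo : (-1.1 : ℝ) < μ - r - A) (hhi : μ + r + A < -0.1)
  {A₃ A₄ : ℝ} (hA₃ : ∀ p : Momentum, ‖iteratedFDeriv ℝ 3 (frameShift K) p‖ ≤ A₃)
  (hA₄ : ∀ p : Momentum, ‖iteratedFDeriv ℝ 4 (frameShift K) p‖ ≤ A₄)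
  {K₁ K₂ K₃ : ℝ} (hK₁ : ∀ p : Momentum, ‖fderiv ℝ (frameLevel μ K) p‖ ≤ K₁) (hK₂ : ∀ p : Momentum, ‖iteratedFDeriv ℝ 2 (frameLevel μ K) p‖ ≤ K₂)
  (hK₃ : ∀ p : Momentum, ‖iteratedFDeriv ℝ 3 (frameLevel μ K) p‖ ≤ K₃)
include hA hA20 hd hr hlo hhi hA₃ hA₄ hK₁ hK₂ hK₃

omit hr hK₁ hK₂ hK₃ in
/-- **Lipschitz transport of a direct-caustic witness over a box**: if `‖S(ϑ₁) − 2Φ(0,v₁+θ)‖ ≤ T` then for all `ϑ, v`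
`‖S(ϑ) − 2Φ(0,v+θ)‖ ≤ T + msD₁·|ϑ − ϑ₁| + 2·msD₁·|v − v₁|` (`S(ϑ) = Φ(0,θ) + Φ(ρ,ϑ+θ)`; angular Lipschitz bound `‖∂_sΦ‖ ≤ msD A₃ A₄ 1`,
`…C4aLoopChordBounds.norm_levelPoint_sub_le_abs`). -/
theorem norm_pairSum_sub_two_smul_le_of_near {ρ : ℝ} (hρ : |ρ| < r) (θ : ℝ) {ϑ₁ v₁ T : ℝ}
    (h : ‖pairSumPath μ K ρ ϑ₁ θ 0 - (2 : ℝ) • levelPoint μ K 0 (v₁ + θ)‖ ≤ T) (ϑ v : ℝ) :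
    ‖pairSumPath μ K ρ ϑ θ 0 - (2 : ℝ) • levelPoint μ K 0 (v + θ)‖ ≤ T + msD A₃ A₄ 1 * |ϑ - ϑ₁| + 2 * (msD A₃ A₄ 1 * |v - v₁|) := by
  have h0 : |(0 : ℝ)| < r := by simpa using lt_of_le_of_lt (abs_nonneg ρ) hρ
  have h1 := norm_levelPoint_sub_le_abs hA hA20 hd hlo hhi hA₃ hA₄ hρ (ϑ + θ + 0) (ϑ₁ + θ + 0)
  have h2 := norm_levelPoint_sub_le_abs hA hA20 hd hlo hhi hA₃ hA₄ h0 (v + θ) (v₁ + θ)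
  rw [show ϑ + θ + 0 - (ϑ₁ + θ + 0) = ϑ - ϑ₁ by ring] at h1
  rw [show v + θ - (v₁ + θ) = v - v₁ by ring] at h2
  have hid : pairSumPath μ K ρ ϑ θ 0 - (2 : ℝ) • levelPoint μ K 0 (v + θ) =
      (pairSumPath μ K ρ ϑ₁ θ 0 - (2 : ℝ) • levelPoint μ K 0 (v₁ + θ)) +
        (levelPoint μ K ρ (ϑ + θ + 0) - levelPoint μ K ρ (ϑ₁ + θ + 0)) - (2 : ℝ) • (levelPoint μ K 0 (v + θ) - levelPoint μ K 0 (v₁ + θ)) := by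
    simp only [pairSumPath, smul_sub]; abel
  rw [hid]
  have h3 : ‖(2 : ℝ) • (levelPoint μ K 0 (v + θ) - levelPoint μ K 0 (v₁ + θ))‖ ≤ 2 * (msD A₃ A₄ 1 * |v - v₁|) := by
    rw [norm_smul, Real.norm_eq_abs, abs_of_pos (by norm_num : (0 : ℝ) < 2)]; exact mul_le_mul_of_nonneg_left h2 (by norm_num)
  calc ‖pairSumPath μ K ρ ϑ₁ θ 0 - (2 : ℝ) • levelPoint μ K 0 (v₁ + θ) +
          (levelPoint μ K ρ (ϑ + θ + 0) - levelPoint μ K ρ (ϑ₁ + θ + 0)) - (2 : ℝ) • (levelPoint μ K 0 (v + θ) - levelPoint μ K 0 (v₁ + θ))‖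
      ≤ ‖pairSumPath μ K ρ ϑ₁ θ 0 - (2 : ℝ) • levelPoint μ K 0 (v₁ + θ) +
          (levelPoint μ K ρ (ϑ + θ + 0) - levelPoint μ K ρ (ϑ₁ + θ + 0))‖ + ‖(2 : ℝ) • (levelPoint μ K 0 (v + θ) - levelPoint μ K 0 (v₁ + θ))‖ := norm_sub_le _ _
    _ ≤ (‖pairSumPath μ K ρ ϑ₁ θ 0 - (2 : ℝ) • levelPoint μ K 0 (v₁ + θ)‖ + ‖levelPoint μ K ρ (ϑ + θ + 0) - levelPoint μ K ρ (ϑ₁ + θ + 0)‖) +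
          ‖(2 : ℝ) • (levelPoint μ K 0 (v + θ) - levelPoint μ K 0 (v₁ + θ))‖ := by gcongr; exact norm_add_le _ _
    _ ≤ (T + msD A₃ A₄ 1 * |ϑ - ϑ₁|) + 2 * (msD A₃ A₄ 1 * |v - v₁|) := by gcongr
    _ = T + msD A₃ A₄ 1 * |ϑ - ϑ₁| + 2 * (msD A₃ A₄ 1 * |v - v₁|) := by ring

set_option maxHeartbeats 400000 in
/-- **THE PER-TILE DISPATCH WITH A CONFIGURATION-DEPENDENT, DIRECT-NULL NUMERATOR** (HEADLINE; see the module docstring): on the `ϑ`-tile `[α, α+ℓ]` with loop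
window `[φa, φb]`, p697550's hypotheses with the numerator rows at every `ϑ` and the direct-null row `hXnull` (threshold `τ₁ ≥ τ₀ + msD₁(ℓ + 2(φb−φa))`) in place of the
zone row `hT0` ⟹ `∫_{α}^{α+ℓ} F ≤ max(b_near, ℓ·max(b_far, b_mono))`, bound byte-identical. -/
theorem umkBox_integral_le {R : RenConsts} {U : ℝ} {N : ℕ} (hF : FrameOK R U N μ K) {Kc r₀ g₀ w : ℝ} (hG : GeomConstants (frameLevel μ K) Kc r₀ g₀ w)
    {ρ : ℝ} (hρ : |ρ| < r) (hρ₀ : |ρ| < 3 / 80) (θ : ℝ)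
    {α ℓ φa φb τ₀ lo hi Wφ Wm qs Δ K₀ X₀ X₁ XL W Afl Bfl Dfl Mρ Γ Γ' η₀ Δc ω d₁ lam eps G₂ : ℝ} {Kr : ℝ → ℝ → ℝ} {X : ℝ → ℝ → ℝ → ℝ} {wt ρm : ℝ → ℝ}
    (hℓ : 0 ≤ ℓ) (hφ : φa ≤ φb) (hWm : 0 ≤ Wm) (hMρ : 0 ≤ Mρ)
    (hWφ : φb - φa + 2 * Wm ≤ Wφ)
    (hmod : K₃ * (τ₀ + msD A₃ A₄ 1 * (ℓ) +
              hi / ((bandBounds (show (-4 : ℝ) < -1.1 by norm_num) (show (-1.1 : ℝ) ≤ -0.1 by norm_num) (show (-0.1 : ℝ) < 0 by norm_num)).Dtmin - 2 * A) +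
              msD A₃ A₄ 1 * Wφ) * msD A₃ A₄ 1 ^ 2 +
          K₂ * (radialRowOneConst A ((bandBounds (show (-4 : ℝ) < -1.1 by norm_num) (show (-1.1 : ℝ) ≤ -0.1 by norm_num) (show (-0.1 : ℝ) < 0 by norm_num)).Dtmin -
                2 * A) * hi + msD A₃ A₄ 2 * Wφ) * (msD A₃ A₄ 1 + msD A₃ A₄ 1) +
          K₂ * (τ₀ + msD A₃ A₄ 1 * (ℓ) +
              hi / ((bandBounds (show (-4 : ℝ) < -1.1 by norm_num) (show (-1.1 : ℝ) ≤ -0.1 by norm_num) (show (-0.1 : ℝ) < 0 by norm_num)).Dtmin - 2 * A) +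
              msD A₃ A₄ 1 * Wφ) * msD A₃ A₄ 2 +
          K₁ * ((uRowTwoConst A A₃ ((bandBounds (show (-4 : ℝ) < -1.1 by norm_num) (show (-1.1 : ℝ) ≤ -0.1 by norm_num) (show (-0.1 : ℝ) < 0 by norm_num)).Dtmin -
                  2 * A) +
                1 / ((bandBounds (show (-4 : ℝ) < -1.1 by norm_num) (show (-1.1 : ℝ) ≤ -0.1 by norm_num) (show (-0.1 : ℝ) < 0 by norm_num)).Dtmin - 2 * A) +
                2 * (radialRowOneConst A ((bandBounds (show (-4 : ℝ) < -1.1 by norm_num) (show (-1.1 : ℝ) ≤ -0.1 by norm_num)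
                    (show (-0.1 : ℝ) < 0 by norm_num)).Dtmin - 2 * A) -
                  1 / ((bandBounds (show (-4 : ℝ) < -1.1 by norm_num) (show (-1.1 : ℝ) ≤ -0.1 by norm_num) (show (-0.1 : ℝ) < 0 by norm_num)).Dtmin - 2 * A))) *
              hi + msD A₃ A₄ 3 * Wφ) ≤
        w * (bandBounds (show (-4 : ℝ) < -1.1 by norm_num) (show (-1.1 : ℝ) ≤ -0.1 by norm_num) (show (-0.1 : ℝ) < 0 by norm_num)).umin ^ 2)
    (hsl : K₂ * msD A₃ A₄ 1 * (τ₀ + msD A₃ A₄ 1 * (ℓ) +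
        2 * (hi / ((bandBounds (show (-4 : ℝ) < -1.1 by norm_num) (show (-1.1 : ℝ) ≤ -0.1 by norm_num) (show (-0.1 : ℝ) < 0 by norm_num)).Dtmin - 2 * A))) ≤
      w * (bandBounds (show (-4 : ℝ) < -1.1 by norm_num) (show (-1.1 : ℝ) ≤ -0.1 by norm_num) (show (-0.1 : ℝ) < 0 by norm_num)).umin ^ 2 * Wm)
    (hrt : K₂ * (τ₀ + msD A₃ A₄ 1 * (ℓ) +
          2 * (hi / ((bandBounds (show (-4 : ℝ) < -1.1 by norm_num) (show (-1.1 : ℝ) ≤ -0.1 by norm_num) (show (-0.1 : ℝ) < 0 by norm_num)).Dtmin - 2 * A) +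
            msD A₃ A₄ 1 * Wφ)) /
        ((bandBounds (show (-4 : ℝ) < -1.1 by norm_num) (show (-1.1 : ℝ) ≤ -0.1 by norm_num) (show (-0.1 : ℝ) < 0 by norm_num)).Dtmin - 2 * A) ≤ 1 / 2)
    (hlo0 : 0 < lo) (hlohi : lo ≤ hi) (hhir : hi < r) (hqs : 3 / 2 ≤ qs) (hX₀ : 0 ≤ X₀) (hX₁ : 0 ≤ X₁) (hXL : 0 ≤ XL) (hW : 0 ≤ W) (hAfl : 0 ≤ Afl) (hBfl : 0 ≤ Bfl)
    (hK₀ : ∀ p : Momentum, |frameLevel μ K p| ≤ K₀) (hK₀pos : 0 < K₀) (hΓ₁ : K₀ ≤ Γ) (hΓ₂ : hi / 2 ≤ Γ) (hΓ'₁ : K₀ ≤ Γ')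
    (hΓ'₂ : w * (bandBounds (show (-4 : ℝ) < -1.1 by norm_num) (show (-1.1 : ℝ) ≤ -0.1 by norm_num) (show (-0.1 : ℝ) < 0 by norm_num)).umin ^ 2 / 2 * (φb - φa + 2 * Wm) ^ 2 ≤ Γ')
    (hΔ : τ₀ + msD A₃ A₄ 1 * (ℓ) + 2 * (msD A₃ A₄ 1 * Wφ) ≤ Δ) (hΔ1 : Δ ≤ 3 / 10) (hΔu : Δ ≤ (bandBounds (show (-4 : ℝ) < -1.1 by norm_num) (show (-1.1 : ℝ) ≤ -0.1 by norm_num) (show (-0.1 : ℝ) < 0 by norm_num)).umin) (hΔr : K₁ * Δ < r) (hDfl : K₁ * Δ ≤ Dfl)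
    (hKd : ∀ e ∈ Icc (-hi) hi, ContDiff ℝ 1 (Kr e)) (hK2d : ∀ e ∈ Icc lo hi, ContDiff ℝ 2 (Kr e))
    (hK0 : ∀ e ∈ Icc (-hi) hi, e ≠ 0 → ∀ u, |Kr e u| ≤ (max |e| |u|)⁻¹) (hK0s : ∀ e ∈ Icc (-lo) lo, ∀ u, |Kr e u| ≤ (max lo |u|)⁻¹)
    (hK1 : ∀ e ∈ Icc (-hi) hi, e ≠ 0 → ∀ u, |deriv (Kr e) u| ≤ (max |e| |u|)⁻¹ ^ 2)
    (hK2 : ∀ e ∈ Icc lo hi, ∀ u, |iteratedDeriv 2 (Kr e) u| ≤ (max e |u|)⁻¹ ^ 3)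
    (hsupp : ∀ e ∈ Icc lo hi, ∀ u, |u| ≤ qs * e → deriv (Kr e) u = 0) (hKc : Continuous fun p : ℝ × ℝ => deriv (Kr p.1) p.2)
    (hflat : ∀ D : ℝ, 0 < D → D ≤ Dfl → |∫ e in lo..hi, wt e * deriv (Kr e) (D - e)| ≤ Afl * (lo / (max D lo) ^ 2) + Bfl)
    (hKn1 : ∀ s ∈ Icc lo hi, ∀ u, s / 2 ≤ u → |deriv (Kr (-s)) u| ≤ ρm s * ((max (u - s) lo)⁻¹ ^ 2))
    (hρ0 : ∀ s ∈ Icc lo hi, 0 ≤ ρm s) (hρc : ContinuousOn ρm (Icc lo hi))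
    (hρtail : ∀ a ∈ Icc lo hi, ∫ s in a..hi, ρm s ≤ Mρ * (lo * (lo / a) ^ 2))
    (hKs1 : ∀ e ∈ Icc (-lo) lo, ∀ u, |deriv (Kr e) u| ≤ (max lo |u|)⁻¹ ^ 2)
    (hXd : ∀ ϑ, ∀ e ∈ Icc (-hi) hi, ContDiff ℝ 1 (X ϑ e)) (hX3 : ContinuousOn (fun p : ℝ × ℝ × ℝ => X p.1 p.2.1 p.2.2) (univ ×ˢ (Icc (-hi) hi ×ˢ univ)))
    (hXs : ∀ ϑ, ∀ e ∈ Icc (-hi) hi, tsupport (X ϑ e) ⊆ Ioo φa φb)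
    (hXb : ∀ ϑ, ∀ e ∈ Icc (-hi) hi, ∀ v, |X ϑ e v| ≤ X₀) (hX₁b : ∀ ϑ, ∀ e ∈ Icc (-hi) hi, ∀ v, |deriv (X ϑ e) v| ≤ X₁)
    (hXLip : ∀ ϑ, ∀ e ∈ Icc lo hi, ∀ v, |X ϑ e v - X ϑ lo v| ≤ XL * |e - lo|)
    (hwc : ContinuousOn wt (Icc (-hi) hi)) (hw0 : ∀ e ∈ Icc (-hi) hi, 0 ≤ wt e) (hwW : ∀ e ∈ Icc (-hi) hi, wt e ≤ W)
    (hsame : τ₀ + 2 * (msD A₃ A₄ 1 * η₀ + |ρ| / ((bandBounds (show (-4 : ℝ) < -1.1 by norm_num) (show (-1.1 : ℝ) ≤ -0.1 by norm_num) (show (-0.1 : ℝ) < 0 by norm_num)).Dtmin - 2 * A)) ≤ 3 / 5)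
    (hΔc : τ₀ + msD A₃ A₄ 1 * ((ℓ) + (φb - φa + 2 * Wm)) ≤ Δc) (hΔc1 : Δc ≤ 3 / 10) (hΔcr : K₁ * Δc < r) (hω₁ : η₀ + (ℓ) ≤ ω) (hω₂ : φb - φa + 2 * Wm ≤ ω)
    (hκ : 0 < 2 / π * (((bandBounds (show (-4 : ℝ) < -1.1 by norm_num) (show (-1.1 : ℝ) ≤ -0.1 by norm_num) (show (-0.1 : ℝ) < 0 by norm_num)).Dtmin - 2 * A) * (bandBounds (show (-4 : ℝ) < -1.1 by norm_num) (show (-1.1 : ℝ) ≤ -0.1 by norm_num) (show (-0.1 : ℝ) < 0 by norm_num)).umin) *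
      ((bandBounds (show (-4 : ℝ) < -1.1 by norm_num) (show (-1.1 : ℝ) ≤ -0.1 by norm_num) (show (-0.1 : ℝ) < 0 by norm_num)).umin * (3 / 200) / (4 + 2 * A) * (η₀ - (ℓ) - π / (2 * (bandBounds (show (-4 : ℝ) < -1.1 by norm_num) (show (-1.1 : ℝ) ≤ -0.1 by norm_num) (show (-0.1 : ℝ) < 0 by norm_num)).umin) * Δc) - π * 7 * (K₁ * Δc + |ρ|) / ((bandBounds (show (-4 : ℝ) < -1.1 by norm_num) (show (-1.1 : ℝ) ≤ -0.1 by norm_num) (show (-0.1 : ℝ) < 0 by norm_num)).Dtmin - 2 * A) ^ 2))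
    (hΓ : 2 / π * (((bandBounds (show (-4 : ℝ) < -1.1 by norm_num) (show (-1.1 : ℝ) ≤ -0.1 by norm_num) (show (-0.1 : ℝ) < 0 by norm_num)).Dtmin - 2 * A) * (bandBounds (show (-4 : ℝ) < -1.1 by norm_num) (show (-1.1 : ℝ) ≤ -0.1 by norm_num) (show (-0.1 : ℝ) < 0 by norm_num)).umin) *
      ((bandBounds (show (-4 : ℝ) < -1.1 by norm_num) (show (-1.1 : ℝ) ≤ -0.1 by norm_num) (show (-0.1 : ℝ) < 0 by norm_num)).umin * (3 / 200) / (4 + 2 * A) * (η₀ - (ℓ) - π / (2 * (bandBounds (show (-4 : ℝ) < -1.1 by norm_num) (show (-1.1 : ℝ) ≤ -0.1 by norm_num) (show (-0.1 : ℝ) < 0 by norm_num)).umin) * Δc) - π * 7 * (K₁ * Δc + |ρ|) / ((bandBounds (show (-4 : ℝ) < -1.1 by norm_num) (show (-1.1 : ℝ) ≤ -0.1 by norm_num) (show (-0.1 : ℝ) < 0 by norm_num)).Dtmin - 2 * A) ^ 2) * (ℓ) ≤ Γ)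
    (hbudget : 2 * (2 * K₃ * Δc * msD A₃ A₄ 1 ^ 2 +
        4 * K₂ * (radialRowOneConst A ((bandBounds (show (-4 : ℝ) < -1.1 by norm_num) (show (-1.1 : ℝ) ≤ -0.1 by norm_num) (show (-0.1 : ℝ) < 0 by norm_num)).Dtmin - 2 * A) * |ρ| + msD A₃ A₄ 2 * ω) * msD A₃ A₄ 1 +
        K₂ * Δc * msD A₃ A₄ 2 +
        K₁ * ((uRowTwoConst A A₃ ((bandBounds (show (-4 : ℝ) < -1.1 by norm_num) (show (-1.1 : ℝ) ≤ -0.1 by norm_num) (show (-0.1 : ℝ) < 0 by norm_num)).Dtmin - 2 * A) + 1 / ((bandBounds (show (-4 : ℝ) < -1.1 by norm_num) (show (-1.1 : ℝ) ≤ -0.1 by norm_num) (show (-0.1 : ℝ) < 0 by norm_num)).Dtmin - 2 * A) +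
              2 * (radialRowOneConst A ((bandBounds (show (-4 : ℝ) < -1.1 by norm_num) (show (-1.1 : ℝ) ≤ -0.1 by norm_num) (show (-0.1 : ℝ) < 0 by norm_num)).Dtmin - 2 * A) - 1 / ((bandBounds (show (-4 : ℝ) < -1.1 by norm_num) (show (-1.1 : ℝ) ≤ -0.1 by norm_num) (show (-0.1 : ℝ) < 0 by norm_num)).Dtmin - 2 * A))) * |ρ| + msD A₃ A₄ 3 * ω)) < 9 / 400 * (bandBounds (show (-4 : ℝ) < -1.1 by norm_num) (show (-1.1 : ℝ) ≤ -0.1 by norm_num) (show (-0.1 : ℝ) < 0 by norm_num)).umin ^ 2)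
    (hhir₀ : hi < r₀) (hhiK : hi ≤ K₀) (hd₁ : 0 < d₁) (hlam : 0 < lam) (hG₂ : 0 ≤ G₂)
    (hhid : K₁ * (hi / ((bandBounds (show (-4 : ℝ) < -1.1 by norm_num) (show (-1.1 : ℝ) ≤ -0.1 by norm_num) (show (-0.1 : ℝ) < 0 by norm_num)).Dtmin - 2 * A)) ≤ d₁ / 2)
    (heps : d₁ + K₁ * (msD A₃ A₄ 1 * (φb - φa)) + K₁ * (hi / ((bandBounds (show (-4 : ℝ) < -1.1 by norm_num) (show (-1.1 : ℝ) ≤ -0.1 by norm_num) (show (-0.1 : ℝ) < 0 by norm_num)).Dtmin - 2 * A)) + hi ≤ eps) (hepsr : eps ≤ r)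
    (hC : ∀ ϑ ∈ Icc α (α + ℓ), ∀ m : Fin 2 → ℤ, msD A₃ A₄ 1 *
            ((π / 2 * lam /
                  (((bandBounds (show (-4 : ℝ) < -1.1 by norm_num) (show (-1.1 : ℝ) ≤ -0.1 by norm_num) (show (-0.1 : ℝ) < 0 by norm_num)).Dtmin -
                      2 * A) *
                    (bandBounds (show (-4 : ℝ) < -1.1 by norm_num) (show (-1.1 : ℝ) ≤ -0.1 by norm_num) (show (-0.1 : ℝ) < 0 by norm_num)).umin) +
                π * Kc * eps / ((bandBounds (show (-4 : ℝ) < -1.1 by norm_num) (show (-1.1 : ℝ) ≤ -0.1 by norm_num) (show (-0.1 : ℝ) < 0 by norm_num)).Dtmin - 2 * A) ^ 2) /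
              ((bandBounds (show (-4 : ℝ) < -1.1 by norm_num) (show (-1.1 : ℝ) ≤ -0.1 by norm_num) (show (-0.1 : ℝ) < 0 by norm_num)).umin * w /
                (4 + 2 * A))) +
          eps / ((bandBounds (show (-4 : ℝ) < -1.1 by norm_num) (show (-1.1 : ℝ) ≤ -0.1 by norm_num) (show (-0.1 : ℝ) < 0 by norm_num)).Dtmin - 2 * A) <
        ‖pairSumPath μ K ρ ϑ θ 0 - WithLp.toLp 2 (fun i => 2 * π * (m i : ℝ))‖)
    (hcurv : ∀ ϑ ∈ Icc α (α + ℓ), ∀ e ∈ Icc (-hi) hi, ∀ v ∈ Icc φa φb,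
      |iteratedDeriv 2 (fun x : ℝ => frameLevel μ K (pairSumPath μ K ρ ϑ θ 0 - levelPoint μ K e (x + θ))) v| ≤ G₂)
    (hτ₀ : msD A₃ A₄ 1 *
            ((π / 2 * lam /
                  (((bandBounds (show (-4 : ℝ) < -1.1 by norm_num) (show (-1.1 : ℝ) ≤ -0.1 by norm_num) (show (-0.1 : ℝ) < 0 by norm_num)).Dtmin -
                      2 * A) *
                    (bandBounds (show (-4 : ℝ) < -1.1 by norm_num) (show (-1.1 : ℝ) ≤ -0.1 by norm_num) (show (-0.1 : ℝ) < 0 by norm_num)).umin) +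
                π * Kc * eps / ((bandBounds (show (-4 : ℝ) < -1.1 by norm_num) (show (-1.1 : ℝ) ≤ -0.1 by norm_num) (show (-0.1 : ℝ) < 0 by norm_num)).Dtmin - 2 * A) ^ 2) /
              ((bandBounds (show (-4 : ℝ) < -1.1 by norm_num) (show (-1.1 : ℝ) ≤ -0.1 by norm_num) (show (-0.1 : ℝ) < 0 by norm_num)).umin * w /
                (4 + 2 * A))) +
          (2 * hi + eps) / ((bandBounds (show (-4 : ℝ) < -1.1 by norm_num) (show (-1.1 : ℝ) ≤ -0.1 by norm_num) (show (-0.1 : ℝ) < 0 by norm_num)).Dtmin -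
            2 * A) ≤ τ₀)
    {τ₁ : ℝ} (hτ₁ : τ₀ + msD A₃ A₄ 1 * (ℓ + 2 * (φb - φa)) ≤ τ₁)
    (hXnull : ∀ ϑ ∈ Icc α (α + ℓ), ∀ e ∈ Icc (-hi) hi, ∀ v, ‖pairSumPath μ K ρ ϑ θ 0 - (2 : ℝ) • levelPoint μ K 0 (v + θ)‖ ≤ τ₁ → X ϑ e v = 0) :
    ∫ ϑ in α..(α + ℓ), |∫ e in (-hi)..hi, ∫ v in φa..φb, wt e * (X ϑ e v * deriv (Kr e) (frameLevel μ K (pairSumPath μ K ρ ϑ θ 0 - levelPoint μ K e (v + θ))))| ≤ max (max (2 * ((2 * (      3 * W * ((4 + 2 * (3 / 2 : ℝ) + 1 / 2) / (1 / 2)) *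
          (X₀ * (4 / Real.sqrt (2 * (K₂ * msD A₃ A₄ 1 ^ 2) +
                    w * (bandBounds (show (-4 : ℝ) < -1.1 by norm_num) (show (-1.1 : ℝ) ≤ -0.1 by norm_num) (show (-0.1 : ℝ) < 0 by norm_num)).umin ^ 2) +
                  16 * Real.sqrt (2 * (K₂ * msD A₃ A₄ 1 ^ 2) +
                        w * (bandBounds (show (-4 : ℝ) < -1.1 by norm_num) (show (-1.1 : ℝ) ≤ -0.1 by norm_num) (show (-0.1 : ℝ) < 0 by norm_num)).umin ^ 2) /
                      (w * (bandBounds (show (-4 : ℝ) < -1.1 by norm_num) (show (-1.1 : ℝ) ≤ -0.1 by norm_num) (show (-0.1 : ℝ) < 0 by norm_num)).umin ^ 2) +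
                  64 * (2 * (K₂ * msD A₃ A₄ 1 ^ 2) +
                          w * (bandBounds (show (-4 : ℝ) < -1.1 by norm_num) (show (-1.1 : ℝ) ≤ -0.1 by norm_num) (show (-0.1 : ℝ) < 0 by norm_num)).umin ^ 2) ^ 2 *
                      Real.sqrt (2 * (K₂ * msD A₃ A₄ 1 ^ 2) +
                          w * (bandBounds (show (-4 : ℝ) < -1.1 by norm_num) (show (-1.1 : ℝ) ≤ -0.1 by norm_num) (show (-0.1 : ℝ) < 0 by norm_num)).umin ^ 2) /
                    (w * (bandBounds (show (-4 : ℝ) < -1.1 by norm_num) (show (-1.1 : ℝ) ≤ -0.1 by norm_num) (show (-0.1 : ℝ) < 0 by norm_num)).umin ^ 2) ^ 3) *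
              Real.sqrt (4 + 2 * (3 / 2 : ℝ) + 1 / 2) +
            32 * X₁ * (2 * (K₂ * msD A₃ A₄ 1 ^ 2) +
                  w * (bandBounds (show (-4 : ℝ) < -1.1 by norm_num) (show (-1.1 : ℝ) ≤ -0.1 by norm_num) (show (-0.1 : ℝ) < 0 by norm_num)).umin ^ 2) /
              (w * (bandBounds (show (-4 : ℝ) < -1.1 by norm_num) (show (-1.1 : ℝ) ≤ -0.1 by norm_num) (show (-0.1 : ℝ) < 0 by norm_num)).umin ^ 2) ^ 2))) * max 1 (Real.sqrt (2 / π * (((bandBounds (show (-4 : ℝ) < -1.1 by norm_num) (show (-1.1 : ℝ) ≤ -0.1 by norm_num) (show (-0.1 : ℝ) < 0 by norm_num)).Dtmin - 2 * A) * (bandBounds (show (-4 : ℝ) < -1.1 by norm_num) (show (-1.1 : ℝ) ≤ -0.1 by norm_num) (show (-0.1 : ℝ) < 0 by norm_num)).umin) *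
      ((bandBounds (show (-4 : ℝ) < -1.1 by norm_num) (show (-1.1 : ℝ) ≤ -0.1 by norm_num) (show (-0.1 : ℝ) < 0 by norm_num)).umin * (3 / 200) / (4 + 2 * A) * (η₀ - (ℓ) - π / (2 * (bandBounds (show (-4 : ℝ) < -1.1 by norm_num) (show (-1.1 : ℝ) ≤ -0.1 by norm_num) (show (-0.1 : ℝ) < 0 by norm_num)).umin) * Δc) - π * 7 * (K₁ * Δc + |ρ|) / ((bandBounds (show (-4 : ℝ) < -1.1 by norm_num) (show (-1.1 : ℝ) ≤ -0.1 by norm_num) (show (-0.1 : ℝ) < 0 by norm_num)).Dtmin - 2 * A) ^ 2)))⁻¹ * (81 * (Γ / (2 / π * (((bandBounds (show (-4 : ℝ) < -1.1 by norm_num) (show (-1.1 : ℝ) ≤ -0.1 by norm_num) (show (-0.1 : ℝ) < 0 by norm_num)).Dtmin - 2 * A) * (bandBounds (show (-4 : ℝ) < -1.1 by norm_num) (show (-1.1 : ℝ) ≤ -0.1 by norm_num) (show (-0.1 : ℝ) < 0 by norm_num)).umin) *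
      ((bandBounds (show (-4 : ℝ) < -1.1 by norm_num) (show (-1.1 : ℝ) ≤ -0.1 by norm_num) (show (-0.1 : ℝ) < 0 by norm_num)).umin * (3 / 200) / (4 + 2 * A) * (η₀ - (ℓ) - π / (2 * (bandBounds (show (-4 : ℝ) < -1.1 by norm_num) (show (-1.1 : ℝ) ≤ -0.1 by norm_num) (show (-0.1 : ℝ) < 0 by norm_num)).umin) * Δc) - π * 7 * (K₁ * Δc + |ρ|) / ((bandBounds (show (-4 : ℝ) < -1.1 by norm_num) (show (-1.1 : ℝ) ≤ -0.1 by norm_num) (show (-0.1 : ℝ) < 0 by norm_num)).Dtmin - 2 * A) ^ 2))) ^ (1 / 4 : ℝ)) *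
          ((ℓ) ^ (3 / 4 : ℝ) / (3 / 4) + (ℓ) ^ (1 / 4 : ℝ) / (1 / 4))))
      ((8 * (32 * (X₀ * Afl + 5 * (W * X₀ * Mρ) + 32 * (W * X₀)) / (3 * Real.sqrt (w * (bandBounds (show (-4 : ℝ) < -1.1 by norm_num) (show (-1.1 : ℝ) ≤ -0.1 by norm_num) (show (-0.1 : ℝ) < 0 by norm_num)).umin ^ 2 / 2))) + 4 * (2 * (      W * (X₀ * (4 / Real.sqrt (2 * (K₂ * msD A₃ A₄ 1 ^ 2) +
                    w * (bandBounds (show (-4 : ℝ) < -1.1 by norm_num) (show (-1.1 : ℝ) ≤ -0.1 by norm_num) (show (-0.1 : ℝ) < 0 by norm_num)).umin ^ 2) + 16 * Real.sqrt (2 * (K₂ * msD A₃ A₄ 1 ^ 2) +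
                    w * (bandBounds (show (-4 : ℝ) < -1.1 by norm_num) (show (-1.1 : ℝ) ≤ -0.1 by norm_num) (show (-0.1 : ℝ) < 0 by norm_num)).umin ^ 2) / (w * (bandBounds (show (-4 : ℝ) < -1.1 by norm_num) (show (-1.1 : ℝ) ≤ -0.1 by norm_num) (show (-0.1 : ℝ) < 0 by norm_num)).umin ^ 2) + 64 * (2 * (K₂ * msD A₃ A₄ 1 ^ 2) +
                    w * (bandBounds (show (-4 : ℝ) < -1.1 by norm_num) (show (-1.1 : ℝ) ≤ -0.1 by norm_num) (show (-0.1 : ℝ) < 0 by norm_num)).umin ^ 2) ^ 2 * Real.sqrt (2 * (K₂ * msD A₃ A₄ 1 ^ 2) +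
                    w * (bandBounds (show (-4 : ℝ) < -1.1 by norm_num) (show (-1.1 : ℝ) ≤ -0.1 by norm_num) (show (-0.1 : ℝ) < 0 by norm_num)).umin ^ 2) / (w * (bandBounds (show (-4 : ℝ) < -1.1 by norm_num) (show (-1.1 : ℝ) ≤ -0.1 by norm_num) (show (-0.1 : ℝ) < 0 by norm_num)).umin ^ 2) ^ 3 +
              2 * Real.sqrt (w * (bandBounds (show (-4 : ℝ) < -1.1 by norm_num) (show (-1.1 : ℝ) ≤ -0.1 by norm_num) (show (-0.1 : ℝ) < 0 by norm_num)).umin ^ 2) / (w * (bandBounds (show (-4 : ℝ) < -1.1 by norm_num) (show (-1.1 : ℝ) ≤ -0.1 by norm_num) (show (-0.1 : ℝ) < 0 by norm_num)).umin ^ 2) + (2 * (K₂ * msD A₃ A₄ 1 ^ 2) +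
                    w * (bandBounds (show (-4 : ℝ) < -1.1 by norm_num) (show (-1.1 : ℝ) ≤ -0.1 by norm_num) (show (-0.1 : ℝ) < 0 by norm_num)).umin ^ 2) * Real.sqrt (w * (bandBounds (show (-4 : ℝ) < -1.1 by norm_num) (show (-1.1 : ℝ) ≤ -0.1 by norm_num) (show (-0.1 : ℝ) < 0 by norm_num)).umin ^ 2) / (w * (bandBounds (show (-4 : ℝ) < -1.1 by norm_num) (show (-1.1 : ℝ) ≤ -0.1 by norm_num) (show (-0.1 : ℝ) < 0 by norm_num)).umin ^ 2) ^ 2) +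
            X₁ * (32 * (2 * (K₂ * msD A₃ A₄ 1 ^ 2) +
                    w * (bandBounds (show (-4 : ℝ) < -1.1 by norm_num) (show (-1.1 : ℝ) ≤ -0.1 by norm_num) (show (-0.1 : ℝ) < 0 by norm_num)).umin ^ 2) * Real.sqrt (K₀ + hi) / (w * (bandBounds (show (-4 : ℝ) < -1.1 by norm_num) (show (-1.1 : ℝ) ≤ -0.1 by norm_num) (show (-0.1 : ℝ) < 0 by norm_num)).umin ^ 2) ^ 2 + (φb - φa + 2 * Wm) * Real.sqrt (w * (bandBounds (show (-4 : ℝ) < -1.1 by norm_num) (show (-1.1 : ℝ) ≤ -0.1 by norm_num) (show (-0.1 : ℝ) < 0 by norm_num)).umin ^ 2) / (w * (bandBounds (show (-4 : ℝ) < -1.1 by norm_num) (show (-1.1 : ℝ) ≤ -0.1 by norm_num) (show (-0.1 : ℝ) < 0 by norm_num)).umin ^ 2))) *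
          ((4 + 2 * (3 / 2 : ℝ) + 1 / 2) * Real.sqrt (4 + 2 * (3 / 2 : ℝ) + 1 / 2) *
                ((1 + Real.log 2 + log⁺ ((1 + 4 * (2 * (K₂ * msD A₃ A₄ 1 ^ 2) +
                    w * (bandBounds (show (-4 : ℝ) < -1.1 by norm_num) (show (-1.1 : ℝ) ≤ -0.1 by norm_num) (show (-0.1 : ℝ) < 0 by norm_num)).umin ^ 2) / (w * (bandBounds (show (-4 : ℝ) < -1.1 by norm_num) (show (-1.1 : ℝ) ≤ -0.1 by norm_num) (show (-0.1 : ℝ) < 0 by norm_num)).umin ^ 2)) * (1 + (3 / 2 : ℝ))) + log⁺ (1 + 4 * (2 * (K₂ * msD A₃ A₄ 1 ^ 2) +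
                    w * (bandBounds (show (-4 : ℝ) < -1.1 by norm_num) (show (-1.1 : ℝ) ≤ -0.1 by norm_num) (show (-0.1 : ℝ) < 0 by norm_num)).umin ^ 2) / (w * (bandBounds (show (-4 : ℝ) < -1.1 by norm_num) (show (-1.1 : ℝ) ≤ -0.1 by norm_num) (show (-0.1 : ℝ) < 0 by norm_num)).umin ^ 2))) + 4) +
            2 * (1 + Real.log 2 + log⁺ ((1 + 4 * (2 * (K₂ * msD A₃ A₄ 1 ^ 2) +
                    w * (bandBounds (show (-4 : ℝ) < -1.1 by norm_num) (show (-1.1 : ℝ) ≤ -0.1 by norm_num) (show (-0.1 : ℝ) < 0 by norm_num)).umin ^ 2) / (w * (bandBounds (show (-4 : ℝ) < -1.1 by norm_num) (show (-1.1 : ℝ) ≤ -0.1 by norm_num) (show (-0.1 : ℝ) < 0 by norm_num)).umin ^ 2)) * (1 + (3 / 2 : ℝ))) + log⁺ (1 + 4 * (2 * (K₂ * msD A₃ A₄ 1 ^ 2) +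
                    w * (bandBounds (show (-4 : ℝ) < -1.1 by norm_num) (show (-1.1 : ℝ) ≤ -0.1 by norm_num) (show (-0.1 : ℝ) < 0 by norm_num)).umin ^ 2) / (w * (bandBounds (show (-4 : ℝ) < -1.1 by norm_num) (show (-1.1 : ℝ) ≤ -0.1 by norm_num) (show (-0.1 : ℝ) < 0 by norm_num)).umin ^ 2))) *
              ((4 + 2 * (3 / 2 : ℝ) + 1 / 2) / (1 / 2) * Real.sqrt ((4 + 2 * (3 / 2 : ℝ) + 1 / 2) / (1 / 2))))))) / Real.sqrt ((9 / 400 * (bandBounds (show (-4 : ℝ) < -1.1 by norm_num) (show (-1.1 : ℝ) ≤ -0.1 by norm_num) (show (-0.1 : ℝ) < 0 by norm_num)).umin ^ 2 - 2 * (2 * K₃ * Δc * msD A₃ A₄ 1 ^ 2 +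
        4 * K₂ * (radialRowOneConst A ((bandBounds (show (-4 : ℝ) < -1.1 by norm_num) (show (-1.1 : ℝ) ≤ -0.1 by norm_num) (show (-0.1 : ℝ) < 0 by norm_num)).Dtmin - 2 * A) * |ρ| + msD A₃ A₄ 2 * ω) * msD A₃ A₄ 1 +
        K₂ * Δc * msD A₃ A₄ 2 +
        K₁ * ((uRowTwoConst A A₃ ((bandBounds (show (-4 : ℝ) < -1.1 by norm_num) (show (-1.1 : ℝ) ≤ -0.1 by norm_num) (show (-0.1 : ℝ) < 0 by norm_num)).Dtmin - 2 * A) + 1 / ((bandBounds (show (-4 : ℝ) < -1.1 by norm_num) (show (-1.1 : ℝ) ≤ -0.1 by norm_num) (show (-0.1 : ℝ) < 0 by norm_num)).Dtmin - 2 * A) +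
              2 * (radialRowOneConst A ((bandBounds (show (-4 : ℝ) < -1.1 by norm_num) (show (-1.1 : ℝ) ≤ -0.1 by norm_num) (show (-0.1 : ℝ) < 0 by norm_num)).Dtmin - 2 * A) - 1 / ((bandBounds (show (-4 : ℝ) < -1.1 by norm_num) (show (-1.1 : ℝ) ≤ -0.1 by norm_num) (show (-0.1 : ℝ) < 0 by norm_num)).Dtmin - 2 * A))) * |ρ| + msD A₃ A₄ 3 * ω))) / 2) + (((64 * W * (1 / (qs + 1 / 2)) ^ 2 * X₀ *
                (K₂ / ((bandBounds (show (-4 : ℝ) < -1.1 by norm_num) (show (-1.1 : ℝ) ≤ -0.1 by norm_num) (show (-0.1 : ℝ) < 0 by norm_num)).Dtmin - 2 * A)) *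
              ((1 / ((bandBounds (show (-4 : ℝ) < -1.1 by norm_num) (show (-1.1 : ℝ) ≤ -0.1 by norm_num) (show (-0.1 : ℝ) < 0 by norm_num)).Dtmin - 2 * A) +
                  msD A₃ A₄ 1 * (π * (4 + 2 * A) * Kc /
                    ((bandBounds (show (-4 : ℝ) < -1.1 by norm_num) (show (-1.1 : ℝ) ≤ -0.1 by norm_num) (show (-0.1 : ℝ) < 0 by norm_num)).umin * w *
                      ((bandBounds (show (-4 : ℝ) < -1.1 by norm_num) (show (-1.1 : ℝ) ≤ -0.1 by norm_num) (show (-0.1 : ℝ) < 0 by norm_num)).Dtmin - 2 * A) ^ 2))) +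
                2 * (1 / (qs + 1 / 2)) /
                  ((bandBounds (show (-4 : ℝ) < -1.1 by norm_num) (show (-1.1 : ℝ) ≤ -0.1 by norm_num) (show (-0.1 : ℝ) < 0 by norm_num)).Dtmin - 2 * A)) +
            4 * W * (1 / (qs + 1 / 2)) ^ 2 * XL + X₀ * Bfl) * (φb - φa + 2 * Wm) +
          8 * (128 * W * (1 / (qs + 1 / 2)) ^ 2 * X₀ *
                (K₂ / ((bandBounds (show (-4 : ℝ) < -1.1 by norm_num) (show (-1.1 : ℝ) ≤ -0.1 by norm_num) (show (-0.1 : ℝ) < 0 by norm_num)).Dtmin - 2 * A)) *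
              msD A₃ A₄ 1) /
            (w * (bandBounds (show (-4 : ℝ) < -1.1 by norm_num) (show (-1.1 : ℝ) ≤ -0.1 by norm_num) (show (-0.1 : ℝ) < 0 by norm_num)).umin ^ 2 / 2) * Real.log 2)) * (ℓ) +
        (4 * (128 * W * (1 / (qs + 1 / 2)) ^ 2 * X₀ *
              (K₂ / ((bandBounds (show (-4 : ℝ) < -1.1 by norm_num) (show (-1.1 : ℝ) ≤ -0.1 by norm_num) (show (-0.1 : ℝ) < 0 by norm_num)).Dtmin - 2 * A)) *
            msD A₃ A₄ 1) /
          (w * (bandBounds (show (-4 : ℝ) < -1.1 by norm_num) (show (-1.1 : ℝ) ≤ -0.1 by norm_num) (show (-0.1 : ℝ) < 0 by norm_num)).umin ^ 2 / 2)) * (2 * (Γ' / ((9 / 400 * (bandBounds (show (-4 : ℝ) < -1.1 by norm_num) (show (-1.1 : ℝ) ≤ -0.1 by norm_num) (show (-0.1 : ℝ) < 0 by norm_num)).umin ^ 2 - 2 * (2 * K₃ * Δc * msD A₃ A₄ 1 ^ 2 +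
        4 * K₂ * (radialRowOneConst A ((bandBounds (show (-4 : ℝ) < -1.1 by norm_num) (show (-1.1 : ℝ) ≤ -0.1 by norm_num) (show (-0.1 : ℝ) < 0 by norm_num)).Dtmin - 2 * A) * |ρ| + msD A₃ A₄ 2 * ω) * msD A₃ A₄ 1 +
        K₂ * Δc * msD A₃ A₄ 2 +
        K₁ * ((uRowTwoConst A A₃ ((bandBounds (show (-4 : ℝ) < -1.1 by norm_num) (show (-1.1 : ℝ) ≤ -0.1 by norm_num) (show (-0.1 : ℝ) < 0 by norm_num)).Dtmin - 2 * A) + 1 / ((bandBounds (show (-4 : ℝ) < -1.1 by norm_num) (show (-1.1 : ℝ) ≤ -0.1 by norm_num) (show (-0.1 : ℝ) < 0 by norm_num)).Dtmin - 2 * A) +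
              2 * (radialRowOneConst A ((bandBounds (show (-4 : ℝ) < -1.1 by norm_num) (show (-1.1 : ℝ) ≤ -0.1 by norm_num) (show (-0.1 : ℝ) < 0 by norm_num)).Dtmin - 2 * A) - 1 / ((bandBounds (show (-4 : ℝ) < -1.1 by norm_num) (show (-1.1 : ℝ) ≤ -0.1 by norm_num) (show (-0.1 : ℝ) < 0 by norm_num)).Dtmin - 2 * A))) * |ρ| + msD A₃ A₄ 3 * ω))) / 2)) ^ (1 / 4 : ℝ)) * (8 * Real.sqrt (ℓ))))
      (ℓ * max (2 * hi * ((φb - φa) * (W * X₀ * (4 / d₁ ^ 2))))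
        (W * ((X₀ * (G₂ / lam ^ 2) + X₁ * lam⁻¹) * (lam⁻¹ * (4 * Real.sqrt K₀))) * (4 * Real.sqrt hi))) := by
  set B := (bandBounds (show (-4 : ℝ) < -1.1 by norm_num) (show (-1.1 : ℝ) ≤ -0.1 by norm_num) (show (-0.1 : ℝ) < 0 by norm_num)) with hBdef
  have e1 : α + ℓ - α = ℓ := add_sub_cancel_left α ℓ
  have e2 : φb + Wm - (φa - Wm) = φb - φa + 2 * Wm := by ring
  have hαβ : α ≤ α + ℓ := le_add_of_nonneg_right hℓ
  have hhi0 : 0 ≤ hi := hlo0.le.trans hlohi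
  have hhh : -hi ≤ hi := by linarith only [hhi0]
  -- the loop bump vanishes off `(φa, φb)`
  have hX0 : ∀ ϑ, ∀ e ∈ Icc (-hi) hi, ∀ v, v ∉ Ioo φa φb → X ϑ e v = 0 := fun ϑ e he v hv =>
    image_eq_zero_of_notMem_tsupport fun h => hv (hXs ϑ e he h)
  have hM0 : 0 ≤ msD A₃ A₄ 1 := (msD_one_pos A₃ A₄).le
  -- the right-hand side is nonnegative (the far bound is)
  have hRHS0 : 0 ≤ ℓ * max (2 * hi * ((φb - φa) * (W * X₀ * (4 / d₁ ^ 2))))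
        (W * ((X₀ * (G₂ / lam ^ 2) + X₁ * lam⁻¹) * (lam⁻¹ * (4 * Real.sqrt K₀))) * (4 * Real.sqrt hi)) := by
    refine mul_nonneg hℓ (le_max_of_le_left ?_)
    have hφ0 : 0 ≤ φb - φa := sub_nonneg.2 hφ
    positivity
  by_cases hT : ∀ ϑ ∈ Icc α (α + ℓ), ∀ v ∈ Icc φa φb, ∀ m : Fin 2 → ℤ, msD A₃ A₄ 1 *
            ((π / 2 * lam /
                  (((bandBounds (show (-4 : ℝ) < -1.1 by norm_num) (show (-1.1 : ℝ) ≤ -0.1 by norm_num) (show (-0.1 : ℝ) < 0 by norm_num)).Dtmin -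
                      2 * A) *
                    (bandBounds (show (-4 : ℝ) < -1.1 by norm_num) (show (-1.1 : ℝ) ≤ -0.1 by norm_num) (show (-0.1 : ℝ) < 0 by norm_num)).umin) +
                π * Kc * eps / ((bandBounds (show (-4 : ℝ) < -1.1 by norm_num) (show (-1.1 : ℝ) ≤ -0.1 by norm_num) (show (-0.1 : ℝ) < 0 by norm_num)).Dtmin - 2 * A) ^ 2) /
              ((bandBounds (show (-4 : ℝ) < -1.1 by norm_num) (show (-1.1 : ℝ) ≤ -0.1 by norm_num) (show (-0.1 : ℝ) < 0 by norm_num)).umin * w /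
                (4 + 2 * A))) +
          (2 * hi + eps) / ((bandBounds (show (-4 : ℝ) < -1.1 by norm_num) (show (-1.1 : ℝ) ≤ -0.1 by norm_num) (show (-0.1 : ℝ) < 0 by norm_num)).Dtmin -
            2 * A) <
        ‖pairSumPath μ K ρ ϑ θ 0 - WithLp.toLp 2 (fun i => 2 * π * (m i : ℝ)) - (2 : ℝ) • levelPoint μ K 0 (v + θ)‖
  · -- NO WITNESS for any sheet at the margin scale: part 10
    have h := noWitnessBox_integral_le_cfg hA hA20 hd hr hlo hhi hA₃ hA₄ hK₁ hG ρ θ (α := α) (β := α + ℓ) (φa := φa) (φb := φb) (d₁ := d₁) (lo := lo) (hi := hi)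
      (lam := lam) (eps := eps) (G₂ := G₂) (X₀ := X₀) (X₁ := X₁) (K₀ := K₀) (W := W) (Kr := Kr) (X := X) (wt := wt)
      hαβ hφ hlo0 hlohi hhir hhir₀ hhiK hd₁ hlam hG₂ hX₀ hX₁ hhid heps hepsr hC hT hK₀ hcurv hXd hXs hX3 (fun ϑ e he v => hXb ϑ e he v)
      (fun ϑ e he v _ => hX₁b ϑ e he v) hKd hKc hK0 hK0s hK1 hKs1 hwc hw0 hwW
    rw [e1] at h
    exact h.trans (le_max_right _ _)
  · -- A WITNESS: part 11′ on the extended loop window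
    push Not at hT
    obtain ⟨ϑ₁, hϑ₁, v₁, hv₁, m, hmτ⟩ := hT
    by_cases hm : m = 0
    · -- A DIRECT-SHEET WITNESS: the numerator vanishes on the whole box, the box integral is `0`
      subst hm
      have hz : (fun i : Fin 2 => 2 * π * (((0 : Fin 2 → ℤ) i : ℤ) : ℝ)) = 0 := by funext i; simp
      rw [hz, WithLp.toLp_zero, sub_zero] at hmτ
      have hwit : ‖pairSumPath μ K ρ ϑ₁ θ 0 - (2 : ℝ) • levelPoint μ K 0 (v₁ + θ)‖ ≤ τ₀ := hmτ.trans hτ₀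
      -- every configuration of the box is within `τ₁` of the direct caustic
      have hnear : ∀ ϑ ∈ Icc α (α + ℓ), ∀ v ∈ Icc φa φb, ‖pairSumPath μ K ρ ϑ θ 0 - (2 : ℝ) • levelPoint μ K 0 (v + θ)‖ ≤ τ₁ := by
        intro ϑ hϑ v hv
        have h := norm_pairSum_sub_two_smul_le_of_near hA hA20 hd hlo hhi hA₃ hA₄ hρ θ hwit ϑ v
        have h1 : |ϑ - ϑ₁| ≤ ℓ := abs_sub_le_iff.2 ⟨by linarith only [hϑ.2, hϑ₁.1], by linarith only [hϑ.1, hϑ₁.2]⟩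
        have h2 : |v - v₁| ≤ φb - φa := abs_sub_le_iff.2 ⟨by linarith only [hv.2, hv₁.1], by linarith only [hv.1, hv₁.2]⟩
        have h3 := mul_le_mul_of_nonneg_left h1 hM0
        have h4 := mul_le_mul_of_nonneg_left h2 hM0
        linarith only [h, h3, h4, hτ₁]
      -- hence the numerator vanishes at every configuration of the box (inside the loop window by `hXnull`, outside by the support row)
      have hXz : ∀ ϑ ∈ Icc α (α + ℓ), ∀ e ∈ Icc (-hi) hi, ∀ v, X ϑ e v = 0 := by
        intro ϑ hϑ e he v
        by_cases hv : v ∈ Ioo φa φb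
        · exact hXnull ϑ hϑ e he v (hnear ϑ hϑ v (Ioo_subset_Icc_self hv))
        · exact hX0 ϑ e he v hv
      have hzero : ∀ ϑ ∈ uIcc α (α + ℓ), |∫ e in (-hi)..hi, ∫ v in φa..φb,
          wt e * (X ϑ e v * deriv (Kr e) (frameLevel μ K (pairSumPath μ K ρ ϑ θ 0 - levelPoint μ K e (v + θ))))| = (fun _ => (0 : ℝ)) ϑ := by
        intro ϑ hϑ
        rw [uIcc_of_le hαβ] at hϑ
        have hin : ∀ e ∈ uIcc (-hi) hi, (∫ v in φa..φb,
            wt e * (X ϑ e v * deriv (Kr e) (frameLevel μ K (pairSumPath μ K ρ ϑ θ 0 - levelPoint μ K e (v + θ))))) = (fun _ => (0 : ℝ)) e := by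
          intro e he
          rw [uIcc_of_le hhh] at he
          simp only [hXz ϑ hϑ e he, zero_mul, mul_zero, intervalIntegral.integral_zero]
        rw [intervalIntegral.integral_congr hin]
        simp
      rw [intervalIntegral.integral_congr hzero]
      simp only [intervalIntegral.integral_zero]
      exact hRHS0.trans (le_max_right _ _)
    have hτ : ‖levelPoint μ K 0 θ - WithLp.toLp 2 (fun i => 2 * π * (m i : ℝ)) + (levelPoint μ K ρ (ϑ₁ + θ) - levelPoint μ K 0 (v₁ + θ)) -
        levelPoint μ K 0 (v₁ + θ)‖ ≤ τ₀ := by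
      have hS : levelPoint μ K 0 θ - WithLp.toLp 2 (fun i => 2 * π * (m i : ℝ)) + (levelPoint μ K ρ (ϑ₁ + θ) - levelPoint μ K 0 (v₁ + θ)) -
          levelPoint μ K 0 (v₁ + θ) = pairSumPath μ K ρ ϑ₁ θ 0 - WithLp.toLp 2 (fun i => 2 * π * (m i : ℝ)) - (2 : ℝ) • levelPoint μ K 0 (v₁ + θ) := by
        simp only [pairSumPath, add_zero, two_smul]; abel
      rw [hS]; exact hmτ.trans hτ₀
    have hv₁' : v₁ ∈ Icc (φa - Wm) (φb + Wm) := ⟨by linarith only [hv₁.1, hWm], by linarith only [hv₁.2, hWm]⟩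
    have hWmα : Wm ≤ v₁ - (φa - Wm) := by linarith only [hv₁.1]
    have hWmβ : Wm ≤ φb + Wm - v₁ := by linarith only [hv₁.2]
    have hφ' : φa - Wm ≤ φb + Wm := by linarith only [hφ, hWm]
    have hXα : ∀ ϑ, ∀ e ∈ Icc (-hi) hi, X ϑ e (φa - Wm) = 0 := fun ϑ e he => hX0 ϑ e he _ fun h => by linarith only [h.1, hWm]
    have hXβ : ∀ ϑ, ∀ e ∈ Icc (-hi) hi, X ϑ e (φb + Wm) = 0 := fun ϑ e he => hX0 ϑ e he _ fun h => by linarith only [h.2, hWm]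
    have h := nearCausticBox_integral_le_cfg hA hA20 hd hr hlo hhi hA₃ hA₄ hK₁ hK₂ hK₃ hF hG hρ hρ₀ θ hm (α := α) (β := α + ℓ) (φa := φa - Wm) (φb := φb + Wm)
      (ϑ₁ := ϑ₁) (φ₁ := v₁) (τ₀ := τ₀) (lo := lo) (hi := hi) (Wφ := Wφ) (Wm := Wm) (qs := qs) (Δ := Δ) (K₀ := K₀) (X₀ := X₀) (X₁ := X₁) (XL := XL) (W := W)
      (Afl := Afl) (Bfl := Bfl) (Dfl := Dfl) (Mρ := Mρ) (Γ := Γ) (Γ' := Γ') (η₀ := η₀) (Δc := Δc) (ω := ω) (Kr := Kr) (X := X) (wt := wt) (ρm := ρm)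
      hαβ hφ' hMρ hϑ₁ hv₁' hτ (by rw [e2]; exact hWφ) hWmα hWmβ (by rw [e1]; exact hmod) (by rw [e1]; exact hsl) (by rw [e1]; exact hrt)
      hlo0 hlohi hhir hqs hX₀ hX₁ hXL hW hAfl hBfl hK₀ hK₀pos hΓ₁ hΓ₂ hΓ'₁ (by rw [e2]; exact hΓ'₂) (by rw [e1]; exact hΔ) hΔ1 hΔu hΔr hDfl
      (fun e he _ => hKd e he) hK2d hK0 hK1 hK2 hsupp hKc hflat hKn1 hρ0 hρc hρtail hKs1 hXd hX3 (fun ϑ e he v _ => hXb ϑ e he v)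
      (fun ϑ e he v _ => hX₁b ϑ e he v) hXα hXβ (fun ϑ e he v _ => hXLip ϑ e he v) hwc hw0 hwW hsame (by rw [e1, e2]; exact hΔc) hΔc1 hΔcr (by rw [e1]; exact hω₁) (by rw [e2]; exact hω₂)
      (by rw [e1]; exact hκ) (by rw [e1]; exact hΓ) hbudget
    rw [e1, e2] at h
    -- the extended loop window integrates the same function of `ϑ`
    have hinner : ∀ ϑ : ℝ, ∀ e ∈ Icc (-hi) hi,
        ∫ v in (φa - Wm)..(φb + Wm), wt e * (X ϑ e v * deriv (Kr e) (frameLevel μ K (pairSumPath μ K ρ ϑ θ 0 - levelPoint μ K e (v + θ)))) =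
        ∫ v in φa..φb, wt e * (X ϑ e v * deriv (Kr e) (frameLevel μ K (pairSumPath μ K ρ ϑ θ 0 - levelPoint μ K e (v + θ)))) := by
      intro ϑ e he
      have hsub : Function.support (fun v => wt e * (X ϑ e v * deriv (Kr e) (frameLevel μ K (pairSumPath μ K ρ ϑ θ 0 - levelPoint μ K e (v + θ))))) ⊆
          Ioc φa φb := by
        intro v hv
        by_contra hv'
        exact hv (by simp only [hX0 ϑ e he v (fun h' => hv' (Ioo_subset_Ioc_self h')), zero_mul, mul_zero])
      rw [intervalIntegral.integral_eq_integral_of_support_subset hsub,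
        intervalIntegral.integral_eq_integral_of_support_subset
          (hsub.trans (Ioc_subset_Ioc (by linarith only [hWm]) (by linarith only [hWm])))]
    have hEq : (fun ϑ : ℝ => |∫ e in (-hi)..hi, ∫ v in (φa - Wm)..(φb + Wm),
          wt e * (X ϑ e v * deriv (Kr e) (frameLevel μ K (pairSumPath μ K ρ ϑ θ 0 - levelPoint μ K e (v + θ))))|) =
        fun ϑ : ℝ => |∫ e in (-hi)..hi, ∫ v in φa..φb,
          wt e * (X ϑ e v * deriv (Kr e) (frameLevel μ K (pairSumPath μ K ρ ϑ θ 0 - levelPoint μ K e (v + θ))))| := by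
      funext ϑ
      rw [intervalIntegral.integral_congr fun e he => hinner ϑ e (by rwa [uIcc_of_le hhh] at he)]
    rw [hEq] at h
    exact h.trans (le_max_left _ _)

end Sizes

end Summit.HubbardSuperconductivity.HubbardSuperconductivity.Theorems.C4a

end
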